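import Mathlib
import Summits.MatrixMultiplication.MatrixMultiplication.Theses.GLnSeparatingDesigns
import Summits.MatrixMultiplication.MatrixMultiplication.Theorems.GLnSeparatingDesignsBorderHalfDimensionDesignsStubNotSplitOfSplitLaw
import Summits.MatrixMultiplication.MatrixMultiplication.Theorems.BorderHalfDimensionDesigns.Negative.SplitDesignBarrier

/-!
# The split form of `BorderHalfDimensionDesigns` is false (E2 assembled, line `Ideate5Sketch`)

Stub `stub_not_splitBorderHalfDimensionDesigns` (crux `BorderHalfDimensionDesigns`, stmt-MatrixMultiplication-18360,
route `GLnSeparatingDesigns`): the crux strengthened to SPLIT FORM — outer sets inside subgroups `H₁ ∋ x`, `H₂ ∋ z⁻¹`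
and one bi-semi-invariant middle test `p₀` of degree `≤ q^(1+δ)` with nonsingular Gram matrix on `Y` (BCGPU 2024
§2.4 / Lemma 2.11's architecture; the strategist's `SplitBorderHalfDimensionDesigns`, inlined) — is FALSE: the
split-design barrier `stub_split_volume_le` (`|X||Y||Z| ≤ s^(n(n−1)/2)·C(2s+n²,n²)`) fed into the numerics
`stub_not_split_of_splitLaw` (ε = 1/8, δ = 1/(16 n)).  Hence every proof of the crux must use NON-SPLIT separators
(in the disprover's grammar: `BorderHalfDimensionDesigns_false_without_nonsplit_separators`); via BCGPU Cor. 2.8 a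
split design certifies only `ω ≤ 3 + o(1)` in `GL_n(ℂ)`.
-/

set_option linter.dupNamespace false

open scoped BigOperators Matrix

namespace Summit.MatrixMultiplication.MatrixMultiplication.Theorems.BorderHalfDimensionDesigns

/-- **The split form of the crux is false** (split-design barrier + numerics at `ε = 1/8`). [folklore] -/
theorem stub_not_splitBorderHalfDimensionDesigns :
    ¬ (∀ ε : ℝ, 0 < ε → ∃ n : ℕ, 3 ≤ n ∧ ∀ δ : ℝ, 0 < δ → ∀ q₀ : ℕ, ∃ q : ℕ, q₀ ≤ q ∧ ∀ η : ℝ, 0 < η →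
      ∃ X Y Z : Finset (Matrix.GeneralLinearGroup (Fin n) ℂ),
        (q : ℝ) ^ ((n : ℝ) ^ 2 / 2 - ε * n) ≤ (X.card : ℝ) ∧
        (q : ℝ) ^ ((n : ℝ) ^ 2 / 2 - ε * n) ≤ (Y.card : ℝ) ∧
        (q : ℝ) ^ ((n : ℝ) ^ 2 / 2 - ε * n) ≤ (Z.card : ℝ) ∧
        (∀ x₀ ∈ X, ∀ z₀ ∈ Z, ∃ p : MvPolynomial (Fin n × Fin n) ℂ,
          (p.totalDegree : ℝ) ≤ (q : ℝ) ^ (1 + δ) ∧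
          ∀ x ∈ X, ∀ y ∈ Y, ∀ y' ∈ Y, ∀ z ∈ Z,
            ((x = x₀ ∧ y = y' ∧ z = z₀) → ‖MvPolynomial.eval (fun ij : Fin n × Fin n =>
              ((x * y⁻¹ * y' * z⁻¹ : Matrix.GeneralLinearGroup (Fin n) ℂ) : Matrix (Fin n) (Fin n) ℂ) ij.1 ij.2) p - 1‖ ≤ η) ∧
            (¬ (x = x₀ ∧ y = y' ∧ z = z₀) → ‖MvPolynomial.eval (fun ij : Fin n × Fin n =>
              ((x * y⁻¹ * y' * z⁻¹ : Matrix.GeneralLinearGroup (Fin n) ℂ) : Matrix (Fin n) (Fin n) ℂ) ij.1 ij.2) p‖ ≤ η)) ∧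
        ∃ (H₁ H₂ : Subgroup (Matrix.GeneralLinearGroup (Fin n) ℂ)) (χ₁ χ₂ : Matrix.GeneralLinearGroup (Fin n) ℂ → ℂ)
          (p₀ : MvPolynomial (Fin n × Fin n) ℂ),
          (∀ x ∈ X, x ∈ H₁) ∧ (∀ z ∈ Z, z⁻¹ ∈ H₂) ∧
          (p₀.totalDegree : ℝ) ≤ (q : ℝ) ^ (1 + δ) ∧
          (∀ h ∈ H₁, ∀ w : Matrix.GeneralLinearGroup (Fin n) ℂ,
            MvPolynomial.eval (fun ij : Fin n × Fin n =>
              ((h * w : Matrix.GeneralLinearGroup (Fin n) ℂ) : Matrix (Fin n) (Fin n) ℂ) ij.1 ij.2) p₀ =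
            χ₁ h * MvPolynomial.eval (fun ij : Fin n × Fin n => (w : Matrix (Fin n) (Fin n) ℂ) ij.1 ij.2) p₀) ∧
          (∀ h ∈ H₂, ∀ w : Matrix.GeneralLinearGroup (Fin n) ℂ,
            MvPolynomial.eval (fun ij : Fin n × Fin n =>
              ((w * h : Matrix.GeneralLinearGroup (Fin n) ℂ) : Matrix (Fin n) (Fin n) ℂ) ij.1 ij.2) p₀ =
            χ₂ h * MvPolynomial.eval (fun ij : Fin n × Fin n => (w : Matrix (Fin n) (Fin n) ℂ) ij.1 ij.2) p₀) ∧
          (Matrix.of fun y y' : ↥Y => MvPolynomial.eval (fun ij : Fin n × Fin n =>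
            ((y.1⁻¹ * y'.1 : Matrix.GeneralLinearGroup (Fin n) ℂ) : Matrix (Fin n) (Fin n) ℂ) ij.1 ij.2) p₀).det ≠ 0) :=
  stub_not_split_of_splitLaw fun _n _s _η hn hs H₁ H₂ χ₁ χ₂ X Y Z hX hZ hread hη p₀ hp₀ hleft hright hGram =>
    stub_split_volume_le hn hs H₁ H₂ χ₁ χ₂ X Y Z hX hZ hread hη p₀ hp₀ hleft hright hGram

end Summit.MatrixMultiplication.MatrixMultiplication.Theorems.BorderHalfDimensionDesigns
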